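import Literature.Analysis.FluidPDE.HouLiAxisModel
import Literature.Analysis.FluidPDE.EnergyToolkit
import Literature.Analysis.PDE.ParabolicMaximumPrinciple1D
import HarnessLib

/-!
# Hou–Li 2008, the maximum principle (74) for `ũ_z² + ṽ_z²` along the 1D axis model — proved

Analysis/FluidPDE proof file (no definitions, no named facts, no `sorry`), companion of
`HouLiAxisModel.lean` (T. Y. Hou, C. Li, *Dynamic stability of the three-dimensional axisymmetric
Navier–Stokes equations with swirl*, Comm. Pure Appl. Math. 61 (2008) 661–697, (22)–(24): the
one-dimensional axis model `(u₁)ₜ + 2ψ₁(u₁)_z = ν(u₁)_zz + 2(ψ₁)_z u₁`,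
`(ω₁)ₜ + 2ψ₁(ω₁)_z = ν(ω₁)_zz + (u₁²)_z`, `−(ψ₁)_zz = ω₁`, typed as `HouLiAxisModel` /
`HouLiAxisModel.IsClassicalSolutionOn`). The named fact `houLi2008_axisModel_globalRegularity`
(Thm. 4: global regularity of the viscous model from smooth periodic data) rests on ONE a-priori
estimate, the printed maximum principle (held text `paper:doi-10-1002-cpa-20212`, 32-page version, p. 18):

> "Differentiating the `ũ`-equation and the `ṽ`-equation with respect to `z`, we get … (66), (67).
> Note that one of the nonlinear terms resulting from differentiating the convection term cancels one
> of the nonlinear terms on the right hand side … (68) `(ũ_z)ₜ + 2ψ̃(ũ_z)_z = −2ũṽ_z + ν(ũ_z)_zz`,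
> (69) `(ṽ_z)ₜ + 2ψ̃(ṽ_z)_z = 2ũũ_z + ν(ṽ_z)_zz`. … Now, we add (70) to (71). Surprisingly, the
> nonlinear vortex stretching-like terms cancel each other. We get (72) … Therefore, equation (72)
> can be rewritten as (73)
> `(ũ_z² + ṽ_z²)ₜ + 2ψ̃(ũ_z² + ṽ_z²)_z = ν(ũ_z² + ṽ_z²)_zz − 2ν[(ũ_zz)² + (ṽ_zz)²]`.
> Thus, the nonlinear quantity `(ũ_z² + ṽ_z²)` satisfies a maximum principle which holds for both
> `ν = 0` and `ν > 0`: (74) `‖ũ_z² + ṽ_z²‖_{L^∞} ≤ ‖(ũ₀)_z² + (ṽ₀)_z²‖_{L^∞}`."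

Here `ũ = u₁ = U` and `ṽ = −(ψ₁)_z`, so that `ṽ_z = −(ψ₁)_zz = ω₁ = Ω` by (24): the printed quantity is
`q = (U_z)² + Ω²`. This file PROVES (74) in the kernel for classical solutions of the typed model on
a closed time slab `[0, T]`, every `ν ≥ 0`:

* `HouLiAxisModel.IsClassicalSolutionOn.sq_deriv_add_sq_le` — if `|Ψ| ≤ V` and `q ≤ W` on
  `[0, T] × ℝ` (automatic for the printed periodic solutions; kept as hypotheses, as in the tree's
  swirl maximum principle `abs_swirl_le_of_classical_of_nonneg`) and `q(0, ·) ≤ M`, then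
  `q(t, z) = (deriv (U t) z)² + (Ω t z)² ≤ M` on `[0, T] × ℝ`;
* `…sq_deriv_add_sq_le_of_periodic` — the printed `1`-periodic setting of Thm. 4: the slab bounds are
  automatic, (74) holds outright on `[0, T]`;
* `…sq_deriv_add_sq_le_of_global` — the same for a global (`Ici 0`) periodic classical solution, the
  output shape of `houLi2008_axisModel_globalRegularity`: `q(t, ·) ≤ sup q(0, ·)` for every `t ≥ 0`
  (with the restriction lemma `IsClassicalSolutionOn.mono`);
* the two remaining a-priori bounds of the printed proof of Thm. 4 (p. 18): `…abs_deriv_Ψ_le_of_periodic`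
  (`‖ṽ‖_{L^∞} ≤ C₀ = √M`, `ṽ = −Ψ_z`; Rolle + mean value in place of the printed Poincaré step) and
  `…abs_U_le` / `…abs_U_le_of_periodic` / `…abs_U_le_of_global`
  (`‖ũ(t)‖_{L^∞} ≤ ‖ũ₀‖_{L^∞} e^{2C₀t}`, one more run of the one-dimensional maximum principle, for the
  linear equation of `e^{−2C₀t} U` whose zeroth-order coefficient `2C₀ − 2Ψ_z` is nonnegative).

PROOF (the printed one): the pointwise identity (73) is derived from (22)–(24) exactly as printed —
differentiate (22) in `z` (the time derivative commutes with `∂_z`,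
`IsSmoothSpaceTimeOn.timeDerivWithin_fderiv_slice_apply`), use (23) as it stands (it IS (69), since
`ṽ_z = ω₁`) and `(ψ₁)_zz = −ω₁`; the two cubic terms `∓4 u₁ ω₁ (u₁)_z` cancel and
`qₜ + 2ψ₁ q_z − ν q_zz = −2ν[(U_zz)² + (Ω_z)²] ≤ 0`. The maximum principle on the unbounded line is
then run through the tree's one-dimensional weak maximum principle on rectangles
(`Literature.Analysis.PDE.nonpos_of_parabolic_subsolution_1d`, Lieberman 1996 Ch. II) applied to
`q − (M + εe^{βt}(1 + z²))`, `β = 2ν + 2V + 1`, on `[−R, R] × [0, T]` with `R ≥ W/ε`, and `ε → 0`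
(the barrier device of `SwirlMaximumPrinciple.lean`).

WHAT THIS IS NOT: not Navier–Stokes and not the discharge of `houLi2008_axisModel_globalRegularity`
(an EXISTENCE statement, which needs a local well-posedness theory for the 1D system that the tree
does not have): it is the a-priori half of Hou–Li's Theorem 4 — the kernel form of SELFSIM-NOGO (M10)'s
mechanism «the exact 1-D axis reduction of axisymmetric Navier–Stokes cannot blow up through
`(u₁)_z` or `ω₁`». MODEL (infinite-energy exact reduction), any `ν ≥ 0`.

## References

* T. Y. Hou, C. Li, Comm. Pure Appl. Math. 61 (2008) 661–697, doi:10.1002/cpa.20212: (22)–(24)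
  p. 6; Thm. 4 and its proof, (66)–(74), pp. 17–18 (held text `paper:doi-10-1002-cpa-20212`,
  p0017–p0018). [`HouLi2007`]
* G. M. Lieberman, *Second order parabolic differential equations*, World Scientific 1996, Ch. II,
  Lemmas 2.1, 2.3 (tree `nonpos_of_parabolic_subsolution_1d`). [`Lieberman1996`]
-/

noncomputable section

open Set Function Filter Topology
open scoped ContDiff

namespace Literature.Analysis.FluidPDE

namespace HouLiAxisModel

/-! ### Restriction of the time set -/

/-- Restriction of the time set: a classical solution of the axis model (22)–(24) on `S` is one on any
`S' ⊆ S` of unique differentiability (`Icc a b`, `Ico a b`, … with `a < b`); needed because the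
one-sided time derivative `timeDerivWithin` depends on the time set (the pattern of
`GeneralizedAxisymNS.IsClassicalSolutionOn.mono`, via `IsSmoothSpaceTimeOn.timeDerivWithin_eq_of_subset`).
[cite: HouLi2007, (22)–(24) (p. 6); restriction is folklore] -/
theorem IsClassicalSolutionOn.mono {S S' : Set ℝ} {ν : ℝ} {U Ω Ψ : ℝ → ℝ → ℝ}
    (h : IsClassicalSolutionOn S ν U Ω Ψ) (hS' : S' ⊆ S) (hU : UniqueDiffOn ℝ S') :
    IsClassicalSolutionOn S' ν U Ω Ψ where
  smooth_U := h.smooth_U.mono hS'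
  smooth_Ω := h.smooth_Ω.mono hS'
  smooth_Ψ := h.smooth_Ψ.mono hS'
  equations t ht z := by
    have e := h.equations t (hS' ht) z
    refine ⟨?_, ?_, e.ψ_eq⟩
    · rw [h.smooth_U.timeDerivWithin_eq_of_subset hS' hU ht z]; exact e.u_eq
    · rw [h.smooth_Ω.timeDerivWithin_eq_of_subset hS' hU ht z]; exact e.ω_eq

/-! ### One-variable helpers (private) -/

/-- Derivatives of a smooth function of one variable are smooth. [folklore] -/
private theorem contDiff_deriv_of_contDiff {φ : ℝ → ℝ} (hφ : ContDiff ℝ ∞ φ) :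
    ContDiff ℝ ∞ (deriv φ) := by
  simpa using hφ.iterate_deriv 1

/-- A smooth function has its `deriv` as derivative everywhere. [folklore] -/
private theorem hasDerivAt_of_contDiff {φ : ℝ → ℝ} (hφ : ContDiff ℝ ∞ φ) (z : ℝ) :
    HasDerivAt φ (deriv φ z) z :=
  (hφ.differentiable (by simp) z).hasDerivAt

/-! ### The maximum principle (74) -/

set_option maxHeartbeats 800000 in
/-- **Hou–Li 2008, the maximum principle (74), proved** (Comm. Pure Appl. Math. 61 (2008), proof of
Thm. 4, p. 18: "the nonlinear quantity `(ũ_z² + ṽ_z²)` satisfies a maximum principle which holds for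
both `ν = 0` and `ν > 0`: `‖ũ_z² + ṽ_z²‖_{L^∞} ≤ ‖(ũ₀)_z² + (ṽ₀)_z²‖_{L^∞}`", `ũ = u₁`,
`ṽ_z = −(ψ₁)_zz = ω₁`). Let `(U, Ω, Ψ)` be a classical solution of the axis model (22)–(24) with
viscosity `ν ≥ 0` on the closed slab `[0, T] × ℝ` (`HouLiAxisModel.IsClassicalSolutionOn (Icc 0 T)`),
with `|Ψ| ≤ V` and `q := (U_z)² + Ω² ≤ W` on the slab (both automatic for smooth `z`-periodic
solutions) and `q(0, ·) ≤ M`. Then `q(t, z) = (deriv (U t) z)² + (Ω t z)² ≤ M` for all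
`(t, z) ∈ [0, T] × ℝ`. Proof: the printed identity (73)
`qₜ + 2Ψ q_z − ν q_zz = −2ν[(U_zz)² + (Ω_z)²] ≤ 0` from (22)–(24), then the one-dimensional weak
maximum principle `nonpos_of_parabolic_subsolution_1d` for `q − (M + εe^{βt}(1 + z²))`,
`β = 2ν + 2V + 1`, on `[−R, R] × [0, T]`, `R ≥ W/ε`, and `ε → 0` (module docstring).
[cite: HouLi2007, Thm. 4 proof, (66)–(74) (pp. 17–18); Lieberman1996, Ch. II Lemma 2.1] -/
theorem IsClassicalSolutionOn.sq_deriv_add_sq_le {ν T V W M : ℝ} {U Ω Ψ : ℝ → ℝ → ℝ}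
    (hν : 0 ≤ ν) (hT : 0 < T) (h : IsClassicalSolutionOn (Icc 0 T) ν U Ω Ψ)
    (hΨ : ∀ t ∈ Icc 0 T, ∀ z, |Ψ t z| ≤ V)
    (hW : ∀ t ∈ Icc 0 T, ∀ z, deriv (U t) z ^ 2 + Ω t z ^ 2 ≤ W)
    (hM : ∀ z, deriv (U 0) z ^ 2 + Ω 0 z ^ 2 ≤ M) :
    ∀ t ∈ Icc 0 T, ∀ z, deriv (U t) z ^ 2 + Ω t z ^ 2 ≤ M := by
  -- the time set
  set S : Set ℝ := Icc 0 T with hSdef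
  have hS : UniqueDiffOn ℝ S := uniqueDiffOn_Icc hT
  have hScl : S ⊆ closure (interior S) := by
    rw [hSdef, interior_Icc, closure_Ioo hT.ne]
  have h0S : (0 : ℝ) ∈ S := ⟨le_rfl, hT.le⟩
  have hV0 : 0 ≤ V := (abs_nonneg _).trans (hΨ 0 h0S 0)
  have hW0 : 0 ≤ W := le_trans (by positivity) (hW 0 h0S 0)
  have hM0 : 0 ≤ M := le_trans (by positivity) (hM 0)
  -- joint smoothness of `U_z = fderiv (U t) z 1` and of the time derivatives
  have hU := h.smooth_U
  have hΩ := h.smooth_Ω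
  have hΨs := h.smooth_Ψ
  have hUz : IsSmoothSpaceTimeOn S (fun t z => fderiv ℝ (U t) z 1) := hU.fderiv_slice_apply hS 1
  -- slice regularity at a time `t ∈ S`: all `z`-derivatives exist
  have hf : ∀ t ∈ S, ContDiff ℝ ∞ (U t) := fun t ht => hU.contDiff_slice ht
  have hg : ∀ t ∈ S, ContDiff ℝ ∞ (Ω t) := fun t ht => hΩ.contDiff_slice ht
  have hp : ∀ t ∈ S, ContDiff ℝ ∞ (Ψ t) := fun t ht => hΨs.contDiff_slice ht
  -- the printed identities at a point `(t, z)`, `t ∈ S`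
  -- (a) the time derivative of `U`, solved from (22), and its `z`-derivative
  have hUt_eq : ∀ t ∈ S, timeDerivWithin S U t = fun z =>
      ν * deriv (deriv (U t)) z + 2 * deriv (Ψ t) z * U t z - 2 * Ψ t z * deriv (U t) z := by
    intro t ht
    funext z
    have e := (h.equations t ht z).u_eq
    linarith
  have hUzt : ∀ t ∈ S, ∀ z, HasDerivAt (timeDerivWithin S U t)
      (ν * deriv (deriv (deriv (U t))) z +
        2 * (deriv (deriv (Ψ t)) z * U t z + deriv (Ψ t) z * deriv (U t) z) -
        2 * (deriv (Ψ t) z * deriv (U t) z + Ψ t z * deriv (deriv (U t)) z)) z := by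
    intro t ht z
    rw [hUt_eq t ht]
    have h1 := (hasDerivAt_of_contDiff (contDiff_deriv_of_contDiff (contDiff_deriv_of_contDiff
      (hf t ht))) z).const_mul ν
    have h2 := ((hasDerivAt_of_contDiff (contDiff_deriv_of_contDiff (hp t ht)) z).mul
      (hasDerivAt_of_contDiff (hf t ht) z)).const_mul 2
    have h3 := ((hasDerivAt_of_contDiff (hp t ht) z).mul
      (hasDerivAt_of_contDiff (contDiff_deriv_of_contDiff (hf t ht)) z)).const_mul 2
    have h := (h1.add h2).sub h3
    refine h.congr_of_eventuallyEq (Eventually.of_forall fun y => ?_)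
    simp only [Pi.add_apply, Pi.sub_apply, Pi.mul_apply]
    ring
  -- (b) `(U²)_z = 2 U U_z`
  have hsq : ∀ t ∈ S, ∀ z, deriv (fun z' => U t z' ^ 2) z = 2 * U t z * deriv (U t) z := by
    intro t ht z
    rw [((hasDerivAt_of_contDiff (hf t ht) z).fun_pow 2).deriv]
    norm_num
  -- (c) the time derivative of `Ω`, solved from (23)
  have hΩt_eq : ∀ t ∈ S, ∀ z, timeDerivWithin S Ω t z =
      ν * deriv (deriv (Ω t)) z + 2 * U t z * deriv (U t) z - 2 * Ψ t z * deriv (Ω t) z := by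
    intro t ht z
    have e := (h.equations t ht z).ω_eq
    rw [hsq t ht z] at e
    linarith
  -- (d) (24): `Ψ_zz = −Ω`
  have hΨzz : ∀ t ∈ S, ∀ z, deriv (deriv (Ψ t)) z = -Ω t z := fun t ht z => by
    have e := (h.equations t ht z).ψ_eq
    linarith
  -- (e) exchange of `∂ₜ` and `∂_z`: the time derivative of `U_z` is `∂_z` of the time derivative
  have hUz_time : ∀ t ∈ S, ∀ z, HasDerivWithinAt (fun s => deriv (U s) z)
      (deriv (timeDerivWithin S U t) z) S t := by
    intro t ht z
    have h1 := hUz.hasDerivWithinAt_timeDerivWithin hS ht z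
    rw [hU.timeDerivWithin_fderiv_slice_apply hS hScl ht z 1] at h1
    exact h1
  -- the barrier constants
  set β : ℝ := 2 * ν + 2 * V + 1 with hβ
  have hβ0 : 0 ≤ β := by rw [hβ]; positivity
  -- the claim for every `ε > 0`, on every large interval
  suffices key : ∀ ε : ℝ, 0 < ε → ∀ R : ℝ, W / ε ≤ R →
      ∀ r ∈ Icc (-R) R, ∀ t ∈ Icc 0 T,
        deriv (U t) r ^ 2 + Ω t r ^ 2 - (M + ε * Real.exp (β * t) * (1 + r ^ 2)) ≤ 0 by
    intro t ht z
    refine le_of_forall_pos_le_add fun η hη => ?_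
    set C : ℝ := Real.exp (β * t) * (1 + z ^ 2) with hC
    have hCpos : 0 < C := by positivity
    have h := key (η / C) (div_pos hη hCpos) (max (W / (η / C)) |z|) (le_max_left _ _) z
      ⟨by linarith [neg_abs_le z, le_max_right (W / (η / C)) |z|],
        (le_abs_self z).trans (le_max_right _ _)⟩ t ht
    have e : η / C * Real.exp (β * t) * (1 + z ^ 2) = η := by
      rw [hC]; field_simp
    rw [e] at h
    linarith
  intro ε hε R hR
  have hR0 : 0 ≤ R := le_trans (by positivity) hR
  -- the functions of the one-dimensional maximum principle (space variable first)
  set u : ℝ → ℝ → ℝ := fun r t =>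
    deriv (U t) r ^ 2 + Ω t r ^ 2 - (M + ε * Real.exp (β * t) * (1 + r ^ 2)) with hu
  set ur : ℝ → ℝ → ℝ := fun r t =>
    2 * deriv (U t) r * deriv (deriv (U t)) r + 2 * Ω t r * deriv (Ω t) r -
      ε * Real.exp (β * t) * (2 * r) with hur
  set urr : ℝ → ℝ → ℝ := fun r t =>
    2 * (deriv (deriv (U t)) r * deriv (deriv (U t)) r +
        deriv (U t) r * deriv (deriv (deriv (U t))) r) +
      2 * (deriv (Ω t) r * deriv (Ω t) r + Ω t r * deriv (deriv (Ω t)) r) -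
      ε * Real.exp (β * t) * 2 with hurr
  set ut : ℝ → ℝ → ℝ := fun r t =>
    2 * deriv (U t) r * deriv (timeDerivWithin S U t) r + 2 * Ω t r * timeDerivWithin S Ω t r -
      ε * (Real.exp (β * t) * β) * (1 + r ^ 2) with hut
  set A : ℝ → ℝ → ℝ := fun _ _ => ν with hA
  set B : ℝ → ℝ → ℝ := fun r t => -2 * Ψ t r with hB
  set Cc : ℝ → ℝ → ℝ := fun _ _ => 0 with hCc
  -- (i) continuity on the rectangle
  have hcont : ContinuousOn (fun p : ℝ × ℝ => u p.1 p.2) (Icc (-R) R ×ˢ Icc 0 T) := by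
    have hswap : Continuous fun p : ℝ × ℝ => ((p.2, p.1) : ℝ × ℝ) := continuous_snd.prodMk continuous_fst
    have hmaps : MapsTo (fun p : ℝ × ℝ => ((p.2, p.1) : ℝ × ℝ)) (Icc (-R) R ×ˢ Icc 0 T)
        (S ×ˢ (univ : Set ℝ)) := fun p hp => ⟨hp.2, mem_univ _⟩
    have h1 : ContinuousOn (fun p : ℝ × ℝ => fderiv ℝ (U p.2) p.1 1) (Icc (-R) R ×ˢ Icc 0 T) :=
      hUz.continuousOn.comp hswap.continuousOn hmaps
    have h2 : ContinuousOn (fun p : ℝ × ℝ => Ω p.2 p.1) (Icc (-R) R ×ˢ Icc 0 T) :=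
      hΩ.continuousOn.comp hswap.continuousOn hmaps
    have h3 : Continuous fun p : ℝ × ℝ => M + ε * Real.exp (β * p.2) * (1 + p.1 ^ 2) := by
      fun_prop
    exact ((h1.pow 2).add (h2.pow 2)).sub h3.continuousOn
  -- (ii) first space derivative
  have hur' : ∀ r ∈ Ioo (-R) R, ∀ t ∈ Ioc 0 T, HasDerivAt (fun r' => u r' t) (ur r t) r := by
    intro r _ t ht
    have htS : t ∈ S := ⟨ht.1.le, ht.2⟩
    have h1 := (hasDerivAt_of_contDiff (contDiff_deriv_of_contDiff (hf t htS)) r).pow 2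
    have h2 := (hasDerivAt_of_contDiff (hg t htS) r).pow 2
    have h3 : HasDerivAt (fun r' : ℝ => M + ε * Real.exp (β * t) * (1 + r' ^ 2))
        (ε * Real.exp (β * t) * (2 * r)) r := by
      have := (((hasDerivAt_id r).pow 2).const_add 1).const_mul (ε * Real.exp (β * t))
      simpa using this.const_add M
    have h := (h1.add h2).sub h3
    refine h.congr_deriv ?_
    simp only [hur, Nat.cast_ofNat]
    ring
  -- (iii) second space derivative
  have hurr' : ∀ r ∈ Ioo (-R) R, ∀ t ∈ Ioc 0 T, HasDerivAt (fun r' => ur r' t) (urr r t) r := by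
    intro r _ t ht
    have htS : t ∈ S := ⟨ht.1.le, ht.2⟩
    have hf1 := hasDerivAt_of_contDiff (contDiff_deriv_of_contDiff (hf t htS)) r
    have hf2 := hasDerivAt_of_contDiff (contDiff_deriv_of_contDiff (contDiff_deriv_of_contDiff
      (hf t htS))) r
    have hg0 := hasDerivAt_of_contDiff (hg t htS) r
    have hg1 := hasDerivAt_of_contDiff (contDiff_deriv_of_contDiff (hg t htS)) r
    have h1 := ((hf1.mul hf2).const_mul 2).add ((hg0.mul hg1).const_mul 2)
    have h3 : HasDerivAt (fun r' : ℝ => ε * Real.exp (β * t) * (2 * r')) (ε * Real.exp (β * t) * 2) r := by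
      simpa using ((hasDerivAt_id r).const_mul 2).const_mul (ε * Real.exp (β * t))
    have h := (h1.sub h3).congr_of_eventuallyEq (f₁ := fun r' => ur r' t)
      (Eventually.of_forall fun y => by
        simp only [hur, Pi.add_apply, Pi.sub_apply, Pi.mul_apply]; ring)
    refine h.congr_deriv ?_
    simp only [hurr]
  -- (iv) the left time derivative
  have hut' : ∀ r ∈ Ioo (-R) R, ∀ t ∈ Ioc 0 T,
      HasDerivWithinAt (fun t' => u r t') (ut r t) (Iic t) t := by
    intro r _ t ht
    have htS : t ∈ S := ⟨ht.1.le, ht.2⟩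
    have h1 := (hUz_time t htS r).pow 2
    have h2 := (hΩ.hasDerivWithinAt_timeDerivWithin hS htS r).pow 2
    have h3 : HasDerivWithinAt (fun t' : ℝ => M + ε * Real.exp (β * t') * (1 + r ^ 2))
        (ε * (Real.exp (β * t) * β) * (1 + r ^ 2)) S t := by
      have e1 : HasDerivAt (fun s => Real.exp (β * s)) (Real.exp (β * t) * β) t := by
        simpa using ((hasDerivAt_id t).const_mul β).exp
      exact (((e1.const_mul ε).mul_const (1 + r ^ 2)).const_add M).hasDerivWithinAt
    have h := ((h1.add h2).sub h3).mono_of_mem_nhdsWithin (Icc_mem_nhdsLE_of_mem ⟨ht.1, ht.2⟩)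
    refine h.congr_deriv ?_
    simp only [hut, Nat.cast_ofNat]
    ring
  -- (v) the differential inequality: the printed cancellation (68)–(73)
  have hL : ∀ r ∈ Ioo (-R) R, ∀ t ∈ Ioc 0 T,
      ut r t - A r t * urr r t - B r t * ur r t + Cc r t * u r t ≤ 0 := by
    intro r _ t ht
    have htS : t ∈ S := ⟨ht.1.le, ht.2⟩
    -- abbreviations for the slice derivatives at `(t, r)`
    have eUzt := (hUzt t htS r).deriv
    have eΩt := hΩt_eq t htS r
    have eΨzz := hΨzz t htS r
    set f0 := U t r with hf0
    set f1 := deriv (U t) r with hf1d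
    set f2 := deriv (deriv (U t)) r with hf2d
    set f3 := deriv (deriv (deriv (U t))) r with hf3d
    set g0 := Ω t r with hg0d
    set g1 := deriv (Ω t) r with hg1d
    set g2 := deriv (deriv (Ω t)) r with hg2d
    set p0 := Ψ t r with hp0d
    set p1 := deriv (Ψ t) r with hp1d
    set c : ℝ := ε * Real.exp (β * t) with hc
    have hc0 : 0 < c := by positivity
    have hp0V : |p0| ≤ V := hΨ t htS r
    -- the value of the operator on `q` is `−2ν (f2² + g1²)`; on the barrier it is controlled by `β`
    have e_ut : ut r t = 2 * f1 * (ν * f3 + 2 * (-g0 * f0 + p1 * f1) - 2 * (p1 * f1 + p0 * f2)) +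
        2 * g0 * (ν * g2 + 2 * f0 * f1 - 2 * p0 * g1) - β * (c * (1 + r ^ 2)) := by
      simp only [hut]
      rw [eUzt, eΩt, eΨzz]
      simp only [hc]
      ring
    have e_ur : ur r t = 2 * f1 * f2 + 2 * g0 * g1 - c * (2 * r) := rfl
    have e_urr : urr r t = 2 * (f2 * f2 + f1 * f3) + 2 * (g1 * g1 + g0 * g2) - c * 2 := rfl
    have e_A : A r t = ν := rfl
    have e_B : B r t = -2 * p0 := rfl
    have e_C : Cc r t = 0 := rfl
    rw [e_ut, e_ur, e_urr, e_A, e_B, e_C]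
    -- the drift term on the barrier: `4 c r p0 ≤ 2 V c (1 + r²)`
    have hdrift : -(2 * V * (c * (1 + r ^ 2))) ≤ 2 * p0 * (c * (2 * r)) := by
      have h1 : |p0 * r| ≤ V * ((1 + r ^ 2) / 2) := by
        rw [abs_mul]
        have hr : |r| ≤ (1 + r ^ 2) / 2 := by nlinarith [sq_abs r, sq_nonneg (|r| - 1), abs_nonneg r]
        exact mul_le_mul hp0V hr (abs_nonneg _) hV0
      have h2 := mul_le_mul_of_nonneg_left (abs_le.1 h1).1 (by positivity : (0 : ℝ) ≤ 4 * c)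
      linarith
    have hvisc : 0 ≤ ν * (2 * (f2 * f2) + 2 * (g1 * g1)) :=
      mul_nonneg hν (by nlinarith [mul_self_nonneg f2, mul_self_nonneg g1])
    have hν2 : ν * (c * 2) ≤ 2 * ν * (c * (1 + r ^ 2)) := by
      nlinarith [mul_nonneg (mul_nonneg hν hc0.le) (sq_nonneg r)]
    have e_β : β * (c * (1 + r ^ 2)) = 2 * ν * (c * (1 + r ^ 2)) + 2 * V * (c * (1 + r ^ 2)) +
        c * (1 + r ^ 2) := by rw [hβ]; ring
    have hcpos : 0 ≤ c * (1 + r ^ 2) := by positivity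
    nlinarith
  -- (vi) the parabolic boundary
  have h0 : ∀ r ∈ Icc (-R) R, u r 0 ≤ 0 := by
    intro r _
    have : u r 0 = deriv (U 0) r ^ 2 + Ω 0 r ^ 2 - (M + ε * Real.exp (β * 0) * (1 + r ^ 2)) := rfl
    rw [this, mul_zero, Real.exp_zero, mul_one]
    have h1 := hM r
    have h2 : 0 ≤ ε * (1 + r ^ 2) := by positivity
    linarith
  have hside : ∀ r, |r| = R → ∀ t ∈ Icc 0 T, u r t ≤ 0 := by
    intro r hr t ht
    have : u r t = deriv (U t) r ^ 2 + Ω t r ^ 2 - (M + ε * Real.exp (β * t) * (1 + r ^ 2)) := rfl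
    rw [this]
    have h1 := hW t ht r
    have hexp1 : 1 ≤ Real.exp (β * t) := Real.one_le_exp (mul_nonneg hβ0 ht.1)
    have hr2 : r ^ 2 = R ^ 2 := by rw [← sq_abs, hr]
    have hWR : W ≤ ε * (1 + r ^ 2) := by
      rw [hr2]
      have e1 : W ≤ ε * R := by rwa [div_le_iff₀' hε] at hR
      have e2 : R ≤ 1 + R ^ 2 := by nlinarith [sq_nonneg (R - 1)]
      nlinarith
    have hH : ε * (1 + r ^ 2) ≤ ε * Real.exp (β * t) * (1 + r ^ 2) := by
      have : ε * (1 + r ^ 2) * 1 ≤ ε * (1 + r ^ 2) * Real.exp (β * t) :=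
        mul_le_mul_of_nonneg_left hexp1 (by positivity)
      linarith
    linarith
  have ha : ∀ t ∈ Icc 0 T, u (-R) t ≤ 0 := fun t ht =>
    hside (-R) (by rw [abs_neg, abs_of_nonneg hR0]) t ht
  have hb : ∀ t ∈ Icc 0 T, u R t ≤ 0 := fun t ht => hside R (abs_of_nonneg hR0) t ht
  -- the one-dimensional weak maximum principle
  have hmp := Literature.Analysis.PDE.nonpos_of_parabolic_subsolution_1d (A := A) (B := B) (C := Cc)
    hcont hur' hurr' hut' (fun _ _ _ _ => hν) (fun _ _ _ _ => le_rfl) hL h0 ha hb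
  intro r hr t ht
  exact hmp r hr t ht

/-- **Hou–Li 2008, (74), in the printed periodic setting** (Thm. 4: data "in `C^m[0, 1]` with
`m ≥ 1` and periodic with period 1"): for a classical solution of the axis model (22)–(24) on
`[0, T] × ℝ`, `ν ≥ 0`, whose slices `U t`, `Ω t`, `Ψ t` are `1`-periodic for every `t ∈ [0, T]`,
the slab bounds of `sq_deriv_add_sq_le` are automatic (jointly continuous, `z`-periodic functions
are bounded on the compact `[0, T] × [0, 1]`), so (74) holds unconditionally: if
`(deriv (U 0) z)² + (Ω 0 z)² ≤ M` for all `z`, then `(deriv (U t) z)² + (Ω t z)² ≤ M` for all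
`t ∈ [0, T]` and all `z`. [cite: HouLi2007, Thm. 4 and its proof, (74) (p. 18)] -/
theorem IsClassicalSolutionOn.sq_deriv_add_sq_le_of_periodic {ν T M : ℝ} {U Ω Ψ : ℝ → ℝ → ℝ}
    (hν : 0 ≤ ν) (hT : 0 < T) (h : IsClassicalSolutionOn (Icc 0 T) ν U Ω Ψ)
    (hper : ∀ t ∈ Icc 0 T, Periodic (U t) 1 ∧ Periodic (Ω t) 1 ∧ Periodic (Ψ t) 1)
    (hM : ∀ z, deriv (U 0) z ^ 2 + Ω 0 z ^ 2 ≤ M) :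
    ∀ t ∈ Icc 0 T, ∀ z, deriv (U t) z ^ 2 + Ω t z ^ 2 ≤ M := by
  set S : Set ℝ := Icc 0 T with hSdef
  have hS : UniqueDiffOn ℝ S := uniqueDiffOn_Icc hT
  -- joint continuity on the compact `[0, T] × [0, 1]` gives the slab bounds by periodicity
  have hK : IsCompact (S ×ˢ Icc (0 : ℝ) 1) := isCompact_Icc.prod isCompact_Icc
  have hUz : IsSmoothSpaceTimeOn S (fun t z => fderiv ℝ (U t) z 1) := h.smooth_U.fderiv_slice_apply hS 1
  -- `Ψ` bound
  have hΨc : ContinuousOn (uncurry Ψ) (S ×ˢ Icc (0 : ℝ) 1) :=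
    h.smooth_Ψ.continuousOn.mono (prod_mono Subset.rfl (subset_univ _))
  obtain ⟨V, hV⟩ := hK.exists_bound_of_continuousOn hΨc
  -- `q` bound
  have hqc : ContinuousOn (fun p : ℝ × ℝ => fderiv ℝ (U p.1) p.2 1 ^ 2 + Ω p.1 p.2 ^ 2)
      (S ×ˢ Icc (0 : ℝ) 1) :=
    ((hUz.continuousOn.pow 2).add (h.smooth_Ω.continuousOn.pow 2)).mono
      (prod_mono Subset.rfl (subset_univ _))
  obtain ⟨W, hW⟩ := hK.exists_bound_of_continuousOn hqc
  -- reduce any `z` to its fractional part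
  have hfr : ∀ {φ : ℝ → ℝ}, Periodic φ 1 → ∀ z, φ z = φ (Int.fract z) := by
    intro φ hφ z
    have e := hφ.sub_int_mul_eq ⌊z⌋ (x := z)
    rw [mul_one, Int.self_sub_floor] at e
    exact e.symm
  have hfract : ∀ t ∈ S, ∀ z, Ψ t z = Ψ t (Int.fract z) ∧
      deriv (U t) z = deriv (U t) (Int.fract z) ∧ Ω t z = Ω t (Int.fract z) := by
    intro t ht z
    obtain ⟨hUp, hΩp, hΨp⟩ := hper t ht
    have hdp : Periodic (deriv (U t)) 1 := by
      intro x
      have hcomp : (fun y => U t (y + 1)) = U t := funext fun y => hUp y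
      rw [← deriv_comp_add_const, hcomp]
    exact ⟨hfr hΨp z, hfr hdp z, hfr hΩp z⟩
  have hΨb : ∀ t ∈ Icc 0 T, ∀ z, |Ψ t z| ≤ V := by
    intro t ht z
    rw [(hfract t ht z).1]
    have := hV (t, Int.fract z) ⟨ht, Int.fract_nonneg z, (Int.fract_lt_one z).le⟩
    simpa [uncurry, Real.norm_eq_abs] using this
  have hWb : ∀ t ∈ Icc 0 T, ∀ z, deriv (U t) z ^ 2 + Ω t z ^ 2 ≤ W := by
    intro t ht z
    rw [(hfract t ht z).2.1, (hfract t ht z).2.2]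
    have := hW (t, Int.fract z) ⟨ht, Int.fract_nonneg z, (Int.fract_lt_one z).le⟩
    rw [Real.norm_eq_abs] at this
    have habs := le_abs_self (fderiv ℝ (U t) (Int.fract z) 1 ^ 2 + Ω t (Int.fract z) ^ 2)
    exact habs.trans this
  exact h.sq_deriv_add_sq_le hν hT hΨb hWb hM

/-- **Hou–Li 2008, (74), for global periodic solutions** — the output shape of the named fact
`houLi2008_axisModel_globalRegularity` (Thm. 4): a classical solution of the axis model (22)–(24) on
`[0, ∞) × ℝ`, `ν ≥ 0`, with `1`-periodic slices for all `t ≥ 0`, satisfies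
`(deriv (U t) z)² + (Ω t z)² ≤ M` for all `t ≥ 0` and all `z` as soon as it does at `t = 0`: the
quantity `(u₁)_z² + ω₁²` of the exact 1D axis reduction never grows (SELFSIM-NOGO (M10), a-priori
half, kernel-checked). [cite: HouLi2007, Thm. 4 and its proof, (74) (p. 18)] -/
theorem IsClassicalSolutionOn.sq_deriv_add_sq_le_of_global {ν M : ℝ} {U Ω Ψ : ℝ → ℝ → ℝ}
    (hν : 0 ≤ ν) (h : IsClassicalSolutionOn (Ici 0) ν U Ω Ψ)
    (hper : ∀ t : ℝ, 0 ≤ t → Periodic (U t) 1 ∧ Periodic (Ω t) 1 ∧ Periodic (Ψ t) 1)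
    (hM : ∀ z, deriv (U 0) z ^ 2 + Ω 0 z ^ 2 ≤ M) :
    ∀ t : ℝ, 0 ≤ t → ∀ z, deriv (U t) z ^ 2 + Ω t z ^ 2 ≤ M := by
  intro t ht z
  have hT : 0 < t + 1 := by linarith
  have h' : IsClassicalSolutionOn (Icc 0 (t + 1)) ν U Ω Ψ :=
    h.mono (fun s hs => hs.1) (uniqueDiffOn_Icc hT)
  exact h'.sq_deriv_add_sq_le_of_periodic hν hT (fun s hs => hper s hs.1) hM t
    ⟨ht, by linarith⟩ z

/-! ### The end of the proof of Thm. 4: the bounds on `ṽ = −ψ̃_z` and on `ũ`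

Printed (p. 18, right after (74)): "Since `ṽ` has zero mean, the Poincaré inequality implies that
`‖ṽ‖_{L^∞} ≤ C₀`, with `C₀` defined by `C₀ = ‖((ũ₀)_z² + (ṽ₀)_z²)^{1/2}‖_{L^∞}`. The boundedness of
`ũ` follows from the bound on `ṽ`: `‖ũ(t)‖_{L^∞} ≤ ‖ũ₀‖_{L^∞} exp(2C₀t)`. The higher order regularity
follows from the standard estimates. This proves Theorem 4." Here `ṽ = −Ψ_z`, `C₀ = √M`. -/

/-- A jointly smooth field on `[0, T] × ℝ` with `1`-periodic slices is bounded on the slab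
(continuity on the compact `[0, T] × [0, 1]` and reduction of `z` to its fractional part). [folklore] -/
private theorem exists_abs_le_of_periodic {T : ℝ} {F : ℝ → ℝ → ℝ}
    (hF : IsSmoothSpaceTimeOn (Icc 0 T) F) (hper : ∀ t ∈ Icc 0 T, Periodic (F t) 1) :
    ∃ V, ∀ t ∈ Icc 0 T, ∀ z, |F t z| ≤ V := by
  have hK : IsCompact (Icc 0 T ×ˢ Icc (0 : ℝ) 1) := isCompact_Icc.prod isCompact_Icc
  have hc : ContinuousOn (uncurry F) (Icc 0 T ×ˢ Icc (0 : ℝ) 1) :=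
    hF.continuousOn.mono (prod_mono Subset.rfl (subset_univ _))
  obtain ⟨V, hV⟩ := hK.exists_bound_of_continuousOn hc
  refine ⟨V, fun t ht z => ?_⟩
  have e : F t z = F t (Int.fract z) := by
    have e := (hper t ht).sub_int_mul_eq ⌊z⌋ (x := z)
    rw [mul_one, Int.self_sub_floor] at e
    exact e.symm
  rw [e]
  have := hV (t, Int.fract z) ⟨ht, Int.fract_nonneg z, (Int.fract_lt_one z).le⟩
  simpa [uncurry, Real.norm_eq_abs] using this

/-- **Hou–Li 2008, Thm. 4 proof — the bound on `ṽ = −ψ̃_z`** (p. 18: "Since `ṽ` has zero mean, the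
Poincaré inequality implies that `‖ṽ‖_{L^∞} ≤ C₀`, with `C₀ = ‖((ũ₀)_z² + (ṽ₀)_z²)^{1/2}‖_{L^∞}`"):
in the printed `1`-periodic setting, if `(deriv (U 0) z)² + (Ω 0 z)² ≤ M` for all `z` then
`|deriv (Ψ t) z| ≤ √M` on `[0, T] × ℝ`, every `ν ≥ 0`. Proof: `Ψ t` is periodic, so by Rolle
`deriv (Ψ t)` vanishes at some `z₀ ∈ (0, 1)` and at all its integer translates; by (24) and (74)
`|deriv (deriv (Ψ t))| = |Ω t| ≤ √M`, and the mean value inequality on a segment of length `≤ 1`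
ending at `z` gives the bound (this replaces the printed Poincaré step, same constant `C₀ = √M`).
[cite: HouLi2007, Thm. 4 proof (p. 18)] -/
theorem IsClassicalSolutionOn.abs_deriv_Ψ_le_of_periodic {ν T M : ℝ} {U Ω Ψ : ℝ → ℝ → ℝ}
    (hν : 0 ≤ ν) (hT : 0 < T) (h : IsClassicalSolutionOn (Icc 0 T) ν U Ω Ψ)
    (hper : ∀ t ∈ Icc 0 T, Periodic (U t) 1 ∧ Periodic (Ω t) 1 ∧ Periodic (Ψ t) 1)
    (hM : ∀ z, deriv (U 0) z ^ 2 + Ω 0 z ^ 2 ≤ M) :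
    ∀ t ∈ Icc 0 T, ∀ z, |deriv (Ψ t) z| ≤ Real.sqrt M := by
  have hq := h.sq_deriv_add_sq_le_of_periodic hν hT hper hM
  intro t ht z
  obtain ⟨-, -, hΨp⟩ := hper t ht
  have hp : ContDiff ℝ ∞ (Ψ t) := h.smooth_Ψ.contDiff_slice ht
  have hp1 : ContDiff ℝ ∞ (deriv (Ψ t)) := contDiff_deriv_of_contDiff hp
  -- (24) and (74): `|Ψ_zz| = |Ω| ≤ √M`
  have hbound : ∀ y, ‖deriv (deriv (Ψ t)) y‖ ≤ Real.sqrt M := by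
    intro y
    have e : deriv (deriv (Ψ t)) y = -Ω t y := by
      have := (h.equations t ht y).ψ_eq
      linarith
    rw [e, Real.norm_eq_abs, abs_neg]
    refine Real.abs_le_sqrt ?_
    nlinarith [hq t ht y, sq_nonneg (deriv (U t) y)]
  -- Rolle: `deriv (Ψ t)` vanishes somewhere in `(0, 1)`
  obtain ⟨z₀, -, hz₀⟩ : ∃ z₀ ∈ Ioo (0 : ℝ) 1, deriv (Ψ t) z₀ = 0 :=
    exists_deriv_eq_zero zero_lt_one hp.continuous.continuousOn (by simpa using (hΨp 0).symm)
  -- … hence at `z₁ = z₀ + ⌊z − z₀⌋`, within distance `1` below `z`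
  have hdp : Periodic (deriv (Ψ t)) 1 := by
    intro x
    have hcomp : (fun y => Ψ t (y + 1)) = Ψ t := funext fun y => hΨp y
    rw [← deriv_comp_add_const, hcomp]
  set z₁ : ℝ := z₀ + (⌊z - z₀⌋ : ℝ) with hz₁
  have hz₁0 : deriv (Ψ t) z₁ = 0 := by
    have e := (hdp.int_mul ⌊z - z₀⌋) z₀
    rw [mul_one] at e
    rw [hz₁, e, hz₀]
  have hdist : ‖z - z₁‖ ≤ 1 := by
    rw [hz₁, Real.norm_eq_abs]
    have e : z - (z₀ + (⌊z - z₀⌋ : ℝ)) = Int.fract (z - z₀) := by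
      rw [← Int.self_sub_floor]
      ring
    rw [e, abs_of_nonneg (Int.fract_nonneg _)]
    exact (Int.fract_lt_one _).le
  -- mean value inequality for `deriv (Ψ t)` between `z₁` and `z`
  have hmv := (convex_univ : Convex ℝ (univ : Set ℝ)).norm_image_sub_le_of_norm_deriv_le
    (f := deriv (Ψ t)) (fun x _ => hp1.differentiable (by simp) x) (fun x _ => hbound x)
    (mem_univ z₁) (mem_univ z)
  rw [hz₁0, sub_zero, Real.norm_eq_abs] at hmv
  calc |deriv (Ψ t) z| ≤ Real.sqrt M * ‖z - z₁‖ := hmv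
    _ ≤ Real.sqrt M * 1 := mul_le_mul_of_nonneg_left hdist (Real.sqrt_nonneg _)
    _ = Real.sqrt M := mul_one _

set_option maxHeartbeats 800000 in
/-- **Hou–Li 2008, Thm. 4 proof — the bound on `ũ`, slab form** (p. 18: "The boundedness of `ũ`
follows from the bound on `ṽ`: `‖ũ(t)‖_{L^∞} ≤ ‖ũ₀‖_{L^∞} exp(2C₀t)`"). Let `(U, Ω, Ψ)` be a
classical solution of the axis model (22)–(24) with `ν ≥ 0` on `[0, T] × ℝ`, with `|Ψ| ≤ V`,
`|Ψ_z| ≤ C₀` and `|U| ≤ W` on the slab (all automatic in the printed periodic setting, with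
`C₀ = √M` by `abs_deriv_Ψ_le_of_periodic`) and `|U(0, ·)| ≤ K`. Then
`|U t z| ≤ K · exp(2C₀ t)` on `[0, T] × ℝ`. Proof: by (22), `v = e^{−2C₀t} U` solves the LINEAR
equation `vₜ − ν v_zz + 2Ψ v_z + (2C₀ − 2Ψ_z) v = 0` with zeroth-order coefficient
`2C₀ − 2Ψ_z ≥ 0`; the one-dimensional weak maximum principle `nonpos_of_parabolic_subsolution_1d`
applied to `±v − (K + εe^{βt}(1 + z²))`, `β = 2ν + 2V + 1`, on `[−R, R] × [0, T]`, `R ≥ W/ε`, and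
`ε → 0` give `|v| ≤ K`. [cite: HouLi2007, Thm. 4 proof (p. 18); Lieberman1996, Ch. II Lemma 2.1] -/
theorem IsClassicalSolutionOn.abs_U_le {ν T V W C₀ K : ℝ} {U Ω Ψ : ℝ → ℝ → ℝ}
    (hν : 0 ≤ ν) (hT : 0 < T) (h : IsClassicalSolutionOn (Icc 0 T) ν U Ω Ψ)
    (hΨ : ∀ t ∈ Icc 0 T, ∀ z, |Ψ t z| ≤ V)
    (hΨz : ∀ t ∈ Icc 0 T, ∀ z, |deriv (Ψ t) z| ≤ C₀)
    (hW : ∀ t ∈ Icc 0 T, ∀ z, |U t z| ≤ W)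
    (hK : ∀ z, |U 0 z| ≤ K) :
    ∀ t ∈ Icc 0 T, ∀ z, |U t z| ≤ K * Real.exp (2 * C₀ * t) := by
  -- the time set
  set S : Set ℝ := Icc 0 T with hSdef
  have hS : UniqueDiffOn ℝ S := uniqueDiffOn_Icc hT
  have h0S : (0 : ℝ) ∈ S := ⟨le_rfl, hT.le⟩
  have hV0 : 0 ≤ V := (abs_nonneg _).trans (hΨ 0 h0S 0)
  have hW0 : 0 ≤ W := (abs_nonneg _).trans (hW 0 h0S 0)
  have hK0 : 0 ≤ K := (abs_nonneg _).trans (hK 0)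
  have hC0 : 0 ≤ C₀ := (abs_nonneg _).trans (hΨz 0 h0S 0)
  have hU := h.smooth_U
  have hf : ∀ t ∈ S, ContDiff ℝ ∞ (U t) := fun t ht => hU.contDiff_slice ht
  -- (22), solved for the time derivative
  have hUt_eq : ∀ t ∈ S, ∀ z, timeDerivWithin S U t z =
      ν * deriv (deriv (U t)) z + 2 * deriv (Ψ t) z * U t z - 2 * Ψ t z * deriv (U t) z := by
    intro t ht z
    have e := (h.equations t ht z).u_eq
    linarith
  -- the constants
  set lam : ℝ := 2 * C₀ with hlam
  have hlam0 : 0 ≤ lam := by rw [hlam]; positivity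
  set β : ℝ := 2 * ν + 2 * V + 1 with hβ
  have hβ0 : 0 ≤ β := by rw [hβ]; positivity
  -- the claim for both signs `σ = ±1`, every `ε > 0`, on every large interval
  suffices key : ∀ σ : ℝ, (σ = 1 ∨ σ = -1) → ∀ ε : ℝ, 0 < ε → ∀ R : ℝ, W / ε ≤ R →
      ∀ r ∈ Icc (-R) R, ∀ t ∈ Icc 0 T,
        σ * (Real.exp (-(lam * t)) * U t r) - (K + ε * Real.exp (β * t) * (1 + r ^ 2)) ≤ 0 by
    intro t ht z
    have hboth : ∀ σ : ℝ, (σ = 1 ∨ σ = -1) → σ * (Real.exp (-(lam * t)) * U t z) ≤ K := by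
      intro σ hσ
      refine le_of_forall_pos_le_add fun η hη => ?_
      set C : ℝ := Real.exp (β * t) * (1 + z ^ 2) with hC
      have hCpos : 0 < C := by positivity
      have h := key σ hσ (η / C) (div_pos hη hCpos) (max (W / (η / C)) |z|) (le_max_left _ _) z
        ⟨by linarith [neg_abs_le z, le_max_right (W / (η / C)) |z|],
          (le_abs_self z).trans (le_max_right _ _)⟩ t ht
      have e : η / C * Real.exp (β * t) * (1 + z ^ 2) = η := by
        rw [hC]; field_simp
      rw [e] at h
      linarith
    have h1 := hboth 1 (Or.inl rfl)
    have h2 := hboth (-1) (Or.inr rfl)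
    have habs : |Real.exp (-(lam * t)) * U t z| ≤ K := abs_le.2 ⟨by linarith, by linarith⟩
    rw [abs_mul, abs_of_pos (Real.exp_pos _)] at habs
    have hE : Real.exp (lam * t) * Real.exp (-(lam * t)) = 1 := by
      rw [← Real.exp_add, add_neg_cancel, Real.exp_zero]
    calc |U t z| = Real.exp (lam * t) * (Real.exp (-(lam * t)) * |U t z|) := by
          rw [← mul_assoc, hE, one_mul]
      _ ≤ Real.exp (lam * t) * K := mul_le_mul_of_nonneg_left habs (Real.exp_pos _).le
      _ = K * Real.exp (2 * C₀ * t) := by rw [hlam, mul_comm]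
  intro σ hσ ε hε R hR
  have hσabs : ∀ x : ℝ, σ * x ≤ |x| := by
    intro x
    rcases hσ with rfl | rfl
    · simpa using le_abs_self x
    · simpa using neg_le_abs x
  have hR0 : 0 ≤ R := le_trans (by positivity) hR
  -- the functions of the one-dimensional maximum principle (space variable first)
  set E : ℝ → ℝ := fun t => Real.exp (-(lam * t)) with hEdef
  have hEpos : ∀ t, 0 < E t := fun t => Real.exp_pos _
  set u : ℝ → ℝ → ℝ := fun r t =>
    σ * (E t * U t r) - (K + ε * Real.exp (β * t) * (1 + r ^ 2)) with hu
  set ur : ℝ → ℝ → ℝ := fun r t =>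
    σ * (E t * deriv (U t) r) - ε * Real.exp (β * t) * (2 * r) with hur
  set urr : ℝ → ℝ → ℝ := fun r t =>
    σ * (E t * deriv (deriv (U t)) r) - ε * Real.exp (β * t) * 2 with hurr
  set ut : ℝ → ℝ → ℝ := fun r t =>
    σ * (E t * -(lam * 1) * U t r + E t * timeDerivWithin S U t r) -
      ε * (Real.exp (β * t) * β) * (1 + r ^ 2) with hut
  set A : ℝ → ℝ → ℝ := fun _ _ => ν with hA
  set B : ℝ → ℝ → ℝ := fun r t => -2 * Ψ t r with hB
  set Cc : ℝ → ℝ → ℝ := fun r t => lam - 2 * deriv (Ψ t) r with hCc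
  -- (i) continuity on the rectangle
  have hcont : ContinuousOn (fun p : ℝ × ℝ => u p.1 p.2) (Icc (-R) R ×ˢ Icc 0 T) := by
    have hswap : Continuous fun p : ℝ × ℝ => ((p.2, p.1) : ℝ × ℝ) := continuous_snd.prodMk continuous_fst
    have hmaps : MapsTo (fun p : ℝ × ℝ => ((p.2, p.1) : ℝ × ℝ)) (Icc (-R) R ×ˢ Icc 0 T)
        (S ×ˢ (univ : Set ℝ)) := fun p hp => ⟨hp.2, mem_univ _⟩
    have h1 : ContinuousOn (fun p : ℝ × ℝ => U p.2 p.1) (Icc (-R) R ×ˢ Icc 0 T) :=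
      hU.continuousOn.comp hswap.continuousOn hmaps
    have h2 : Continuous fun p : ℝ × ℝ => σ * Real.exp (-(lam * p.2)) := by fun_prop
    have h3 : Continuous fun p : ℝ × ℝ => K + ε * Real.exp (β * p.2) * (1 + p.1 ^ 2) := by
      fun_prop
    refine ((h2.continuousOn.mul h1).sub h3.continuousOn).congr fun p _ => ?_
    simp only [hu, hEdef, Pi.mul_apply, Pi.sub_apply]
    ring
  -- (ii) first space derivative
  have hur' : ∀ r ∈ Ioo (-R) R, ∀ t ∈ Ioc 0 T, HasDerivAt (fun r' => u r' t) (ur r t) r := by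
    intro r _ t ht
    have htS : t ∈ S := ⟨ht.1.le, ht.2⟩
    have h1 := ((hasDerivAt_of_contDiff (hf t htS) r).const_mul (E t)).const_mul σ
    have h3 : HasDerivAt (fun r' : ℝ => K + ε * Real.exp (β * t) * (1 + r' ^ 2))
        (ε * Real.exp (β * t) * (2 * r)) r := by
      have := (((hasDerivAt_id r).pow 2).const_add 1).const_mul (ε * Real.exp (β * t))
      simpa using this.const_add K
    exact h1.sub h3
  -- (iii) second space derivative
  have hurr' : ∀ r ∈ Ioo (-R) R, ∀ t ∈ Ioc 0 T, HasDerivAt (fun r' => ur r' t) (urr r t) r := by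
    intro r _ t ht
    have htS : t ∈ S := ⟨ht.1.le, ht.2⟩
    have h1 := ((hasDerivAt_of_contDiff (contDiff_deriv_of_contDiff (hf t htS)) r).const_mul
      (E t)).const_mul σ
    have h3 : HasDerivAt (fun r' : ℝ => ε * Real.exp (β * t) * (2 * r')) (ε * Real.exp (β * t) * 2) r := by
      simpa using ((hasDerivAt_id r).const_mul 2).const_mul (ε * Real.exp (β * t))
    exact h1.sub h3
  -- (iv) the left time derivative
  have hut' : ∀ r ∈ Ioo (-R) R, ∀ t ∈ Ioc 0 T,
      HasDerivWithinAt (fun t' => u r t') (ut r t) (Iic t) t := by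
    intro r _ t ht
    have htS : t ∈ S := ⟨ht.1.le, ht.2⟩
    have hE' : HasDerivAt E (E t * -(lam * 1)) t := ((hasDerivAt_id' t).const_mul lam).neg.exp
    have h1 := (hE'.hasDerivWithinAt.mul (hU.hasDerivWithinAt_timeDerivWithin hS htS r)).const_mul σ
    have h3 : HasDerivWithinAt (fun t' : ℝ => K + ε * Real.exp (β * t') * (1 + r ^ 2))
        (ε * (Real.exp (β * t) * β) * (1 + r ^ 2)) S t := by
      have e1 : HasDerivAt (fun s => Real.exp (β * s)) (Real.exp (β * t) * β) t := by
        simpa using ((hasDerivAt_id t).const_mul β).exp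
      exact (((e1.const_mul ε).mul_const (1 + r ^ 2)).const_add K).hasDerivWithinAt
    exact ((h1.sub h3).mono_of_mem_nhdsWithin (Icc_mem_nhdsLE_of_mem ⟨ht.1, ht.2⟩))
  -- (v) the differential inequality: `v = e^{−2C₀t} U` solves a linear equation with `c ≥ 0`
  have hCc0 : ∀ r ∈ Ioo (-R) R, ∀ t ∈ Ioc 0 T, 0 ≤ Cc r t := by
    intro r _ t ht
    have h1 := (abs_le.1 (hΨz t ⟨ht.1.le, ht.2⟩ r)).2
    show 0 ≤ lam - 2 * deriv (Ψ t) r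
    rw [hlam]
    linarith
  have hL : ∀ r ∈ Ioo (-R) R, ∀ t ∈ Ioc 0 T,
      ut r t - A r t * urr r t - B r t * ur r t + Cc r t * u r t ≤ 0 := by
    intro r hr t ht
    have htS : t ∈ S := ⟨ht.1.le, ht.2⟩
    have eUt := hUt_eq t htS r
    have hCc' : 0 ≤ Cc r t := hCc0 r hr t ht
    set f0 := U t r with hf0
    set f1 := deriv (U t) r with hf1d
    set f2 := deriv (deriv (U t)) r with hf2d
    set p0 := Ψ t r with hp0d
    set p1 := deriv (Ψ t) r with hp1d
    set c : ℝ := ε * Real.exp (β * t) with hc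
    have hc0 : 0 < c := by positivity
    have hp0V : |p0| ≤ V := hΨ t htS r
    have e_ut : ut r t = σ * (E t * -(lam * 1) * f0 +
        E t * (ν * f2 + 2 * p1 * f0 - 2 * p0 * f1)) - β * (c * (1 + r ^ 2)) := by
      simp only [hut]
      rw [eUt]
      simp only [hc]
      ring
    have e_ur : ur r t = σ * (E t * f1) - c * (2 * r) := rfl
    have e_urr : urr r t = σ * (E t * f2) - c * 2 := rfl
    have e_u : u r t = σ * (E t * f0) - (K + c * (1 + r ^ 2)) := rfl
    have e_A : A r t = ν := rfl
    have e_B : B r t = -2 * p0 := rfl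
    have e_C : Cc r t = lam - 2 * p1 := rfl
    rw [e_C] at hCc'
    rw [e_ut, e_ur, e_urr, e_u, e_A, e_B, e_C]
    -- the drift term on the barrier: `−4 c r p0 ≤ 2 V c (1 + r²)`
    have hdrift : -(2 * V * (c * (1 + r ^ 2))) ≤ 2 * p0 * (c * (2 * r)) := by
      have h1 : |p0 * r| ≤ V * ((1 + r ^ 2) / 2) := by
        rw [abs_mul]
        have hr : |r| ≤ (1 + r ^ 2) / 2 := by nlinarith [sq_abs r, sq_nonneg (|r| - 1), abs_nonneg r]
        exact mul_le_mul hp0V hr (abs_nonneg _) hV0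
      have h2 := mul_le_mul_of_nonneg_left (abs_le.1 h1).1 (by positivity : (0 : ℝ) ≤ 4 * c)
      linarith
    have hν2 : ν * (c * 2) ≤ 2 * ν * (c * (1 + r ^ 2)) := by
      nlinarith [mul_nonneg (mul_nonneg hν hc0.le) (sq_nonneg r)]
    have e_β : β * (c * (1 + r ^ 2)) = 2 * ν * (c * (1 + r ^ 2)) + 2 * V * (c * (1 + r ^ 2)) +
        c * (1 + r ^ 2) := by rw [hβ]; ring
    have hcpos : 0 ≤ c * (1 + r ^ 2) := by positivity
    have hKh : 0 ≤ (lam - 2 * p1) * (K + c * (1 + r ^ 2)) := mul_nonneg hCc' (by positivity)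
    nlinarith [hdrift, hν2, e_β, hcpos, hKh]
  -- (vi) the parabolic boundary
  have h0 : ∀ r ∈ Icc (-R) R, u r 0 ≤ 0 := by
    intro r _
    have e : u r 0 = σ * (Real.exp (-(lam * 0)) * U 0 r) -
        (K + ε * Real.exp (β * 0) * (1 + r ^ 2)) := rfl
    rw [e]
    simp only [mul_zero, neg_zero, Real.exp_zero, one_mul, mul_one]
    have h1 := hσabs (U 0 r)
    have h2 := hK r
    have h3 : 0 ≤ ε * (1 + r ^ 2) := by positivity
    linarith
  have hside : ∀ r, |r| = R → ∀ t ∈ Icc 0 T, u r t ≤ 0 := by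
    intro r hr t ht
    have e : u r t = σ * (E t * U t r) - (K + ε * Real.exp (β * t) * (1 + r ^ 2)) := rfl
    rw [e]
    have h1 := hW t ht r
    have h2 : σ * (E t * U t r) ≤ |U t r| := by
      have h3 := hσabs (E t * U t r)
      rw [abs_mul, abs_of_pos (hEpos t)] at h3
      have hE1 : E t ≤ 1 := by
        show Real.exp (-(lam * t)) ≤ 1
        rw [Real.exp_le_one_iff]
        nlinarith [ht.1]
      have h4 : E t * |U t r| ≤ 1 * |U t r| :=
        mul_le_mul_of_nonneg_right hE1 (abs_nonneg _)
      linarith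
    have hexp1 : 1 ≤ Real.exp (β * t) := Real.one_le_exp (mul_nonneg hβ0 ht.1)
    have hr2 : r ^ 2 = R ^ 2 := by rw [← sq_abs, hr]
    have hWR : W ≤ ε * (1 + r ^ 2) := by
      rw [hr2]
      have e1 : W ≤ ε * R := by rwa [div_le_iff₀' hε] at hR
      have e2 : R ≤ 1 + R ^ 2 := by nlinarith [sq_nonneg (R - 1)]
      nlinarith
    have hH : ε * (1 + r ^ 2) ≤ ε * Real.exp (β * t) * (1 + r ^ 2) := by
      have : ε * (1 + r ^ 2) * 1 ≤ ε * (1 + r ^ 2) * Real.exp (β * t) :=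
        mul_le_mul_of_nonneg_left hexp1 (by positivity)
      linarith
    linarith
  have ha : ∀ t ∈ Icc 0 T, u (-R) t ≤ 0 := fun t ht =>
    hside (-R) (by rw [abs_neg, abs_of_nonneg hR0]) t ht
  have hb : ∀ t ∈ Icc 0 T, u R t ≤ 0 := fun t ht => hside R (abs_of_nonneg hR0) t ht
  -- the one-dimensional weak maximum principle
  have hmp := Literature.Analysis.PDE.nonpos_of_parabolic_subsolution_1d (A := A) (B := B) (C := Cc)
    hcont hur' hurr' hut' (fun _ _ _ _ => hν) hCc0 hL h0 ha hb
  intro r hr t ht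
  exact hmp r hr t ht

/-- **Hou–Li 2008, Thm. 4 proof — the bound on `ũ`, printed periodic form**: in the `1`-periodic
setting of Thm. 4 the slab bounds of `abs_U_le` are automatic and `C₀ = √M`
(`abs_deriv_Ψ_le_of_periodic`), so: if `(deriv (U 0) z)² + (Ω 0 z)² ≤ M` and `|U 0 z| ≤ K` for all
`z`, then `|U t z| ≤ K · exp(2√M · t)` on `[0, T] × ℝ`, every `ν ≥ 0` — the printed
`‖ũ(t)‖_{L^∞} ≤ ‖ũ₀‖_{L^∞} exp(2C₀t)`. [cite: HouLi2007, Thm. 4 proof (p. 18)] -/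
theorem IsClassicalSolutionOn.abs_U_le_of_periodic {ν T M K : ℝ} {U Ω Ψ : ℝ → ℝ → ℝ}
    (hν : 0 ≤ ν) (hT : 0 < T) (h : IsClassicalSolutionOn (Icc 0 T) ν U Ω Ψ)
    (hper : ∀ t ∈ Icc 0 T, Periodic (U t) 1 ∧ Periodic (Ω t) 1 ∧ Periodic (Ψ t) 1)
    (hM : ∀ z, deriv (U 0) z ^ 2 + Ω 0 z ^ 2 ≤ M) (hK : ∀ z, |U 0 z| ≤ K) :
    ∀ t ∈ Icc 0 T, ∀ z, |U t z| ≤ K * Real.exp (2 * Real.sqrt M * t) := by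
  obtain ⟨V, hV⟩ := exists_abs_le_of_periodic h.smooth_Ψ fun t ht => (hper t ht).2.2
  obtain ⟨W, hW⟩ := exists_abs_le_of_periodic h.smooth_U fun t ht => (hper t ht).1
  exact h.abs_U_le hν hT hV (h.abs_deriv_Ψ_le_of_periodic hν hT hper hM) hW hK

/-- **Hou–Li 2008, Thm. 4 proof — the a-priori bounds for global periodic solutions** (the output
shape of `houLi2008_axisModel_globalRegularity`): a classical solution of (22)–(24) on `[0, ∞) × ℝ`,
`ν ≥ 0`, with `1`-periodic slices, `(deriv (U 0) z)² + (Ω 0 z)² ≤ M` and `|U 0 z| ≤ K`, satisfies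
`|deriv (Ψ t) z| ≤ √M` and `|U t z| ≤ K · exp(2√M · t)` for all `t ≥ 0` and all `z` (printed:
`‖ṽ‖_{L^∞} ≤ C₀`, `‖ũ(t)‖_{L^∞} ≤ ‖ũ₀‖_{L^∞} exp(2C₀t)`). [cite: HouLi2007, Thm. 4 proof (p. 18)] -/
theorem IsClassicalSolutionOn.abs_U_le_of_global {ν M K : ℝ} {U Ω Ψ : ℝ → ℝ → ℝ}
    (hν : 0 ≤ ν) (h : IsClassicalSolutionOn (Ici 0) ν U Ω Ψ)
    (hper : ∀ t : ℝ, 0 ≤ t → Periodic (U t) 1 ∧ Periodic (Ω t) 1 ∧ Periodic (Ψ t) 1)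
    (hM : ∀ z, deriv (U 0) z ^ 2 + Ω 0 z ^ 2 ≤ M) (hK : ∀ z, |U 0 z| ≤ K) :
    ∀ t : ℝ, 0 ≤ t → ∀ z, |deriv (Ψ t) z| ≤ Real.sqrt M ∧
      |U t z| ≤ K * Real.exp (2 * Real.sqrt M * t) := by
  intro t ht z
  have hT : 0 < t + 1 := by linarith
  have h' : IsClassicalSolutionOn (Icc 0 (t + 1)) ν U Ω Ψ :=
    h.mono (fun s hs => hs.1) (uniqueDiffOn_Icc hT)
  have hper' : ∀ s ∈ Icc 0 (t + 1), Periodic (U s) 1 ∧ Periodic (Ω s) 1 ∧ Periodic (Ψ s) 1 :=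
    fun s hs => hper s hs.1
  have hts : t ∈ Icc 0 (t + 1) := ⟨ht, by linarith⟩
  exact ⟨h'.abs_deriv_Ψ_le_of_periodic hν hT hper' hM t hts z,
    h'.abs_U_le_of_periodic hν hT hper' hM hK t hts z⟩

end HouLiAxisModel

end Literature.Analysis.FluidPDE

end
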